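import Summits.SmoothPoincare4.SmoothPoincare4.Theorems.SymplecticOrigamiOrigamiFoldExistenceShadowPleatsNormalisationCert
import Summits.SmoothPoincare4.SmoothPoincare4.Theorems.SymplecticOrigamiOrigamiFoldExistenceShadowPleatsOuterCleanDefs

/-!
# Upper slack bound of `stub_outerNormalisation` (line `shadow-pleats`, crux `OrigamiFoldExistence`)
(item stmt-SmoothPoincare4-7844, route route-SmoothPoincare4-SymplecticOrigami; line lead seat c3, skeleton r5/r6)

From r5 on the open stub of the line is OUTER NORMALISATION: every pleated round-rim position of a homotopy 4-sphere
can be replaced by an un-nested position with at most one chart whose OUTER crease is embedded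
(`HasOuterCleanPleatedPosition`, `…ShadowPleatsOuterCleanDefs.lean`, p113294).  This file records, in kernel form,
the ONE direction of its slack that is provable: `SmoothPoincare4` implies the stub verbatim (with `k' = 0`), by
transport of the round sphere's clean 0-chart position (`hasCleanPleatedPosition_zero_of_nonempty_diffeomorph`,
`…NormalisationCert.lean`, p113474) — for at most one chart a clean position is an outer-clean un-nested one
(`HasCleanPleatedPosition.hasOuterCleanPleatedPosition_of_le_one`).

The CONVERSE is deliberately absent and is NOT known: by the lead's outer-clean recognition theorem
(`OuterClean-analysis-c3.md`; kernel glue `nonempty_diffeomorph_of_chartComplement`, p118158) the stub implies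
`SmoothPoincare4` only together with the smooth 4-dimensional Schoenflies conjecture (and Cerf's `Γ₄ = 0`); whether it
is SPC4-equivalent on its own is the realisability question (R) of the analysis note.  So, unlike its predecessors
`stub_pleatCollapse` (p96867) and `stub_pleatNormalisation` (p113474), this stub is NOT certified zero-slack.
-/

noncomputable section

-- the prescribed namespace `Summit.<P>.<Sub>.…` duplicates `SmoothPoincare4` (P = Sub)
set_option linter.dupNamespace false

open scoped Manifold ContDiff Topology
open Set Function ContinuousMap

namespace Summit.SmoothPoincare4.SmoothPoincare4.Theorems.OrigamiFoldExistence.ShadowPleats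

/-- **`SmoothPoincare4` implies `stub_outerNormalisation` (kernel form of the upper slack bound).** A homotopy
4-sphere is then diffeomorphic to the round `S⁴ ⊂ ℝ⁵`, whose inclusion is a clean, hence outer-clean un-nested,
0-chart position; positions transport along diffeomorphisms.  The given `k`-chart position is ignored. [folklore] -/
theorem stub_outerNormalisation_of_smoothPoincare4 (hS : _root_.SmoothPoincare4) :
    ∀ (M : Type) [TopologicalSpace M] [T2Space M] [SecondCountableTopology M]
      [ChartedSpace (EuclideanSpace ℝ (Fin 4)) M] [IsManifold (𝓡 4) ∞ M],
      M ≃ₕ (Metric.sphere (0 : EuclideanSpace ℝ (Fin 5)) 1) →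
      ∀ k, HasPleatedPosition M k → ∃ k', k' ≤ 1 ∧ HasOuterCleanPleatedPosition M k' := by
  intro M _ _ _ _ _ hM k _
  have hS' := hS
  unfold _root_.SmoothPoincare4 Literature.SPC4.SmoothPoincareConjectureFour
    ContinuousMap.HomotopyEquiv.NonemptyDiffeomorphSphere at hS'
  exact ⟨0, Nat.zero_le 1,
    (hasCleanPleatedPosition_zero_of_nonempty_diffeomorph (hS' M inferInstance inferInstance hM))
      |>.hasOuterCleanPleatedPosition_of_le_one (Nat.zero_le 1)⟩

end Summit.SmoothPoincare4.SmoothPoincare4.Theorems.OrigamiFoldExistence.ShadowPleats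

end
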